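import Summits.KontsevichZagierPeriods.KontsevichZagierPeriods.Theses.SphericalSchlafli
import Summits.KontsevichZagierPeriods.KontsevichZagierPeriods.Theorems.InverseLandauTateLiftingCoxeterChamberTiling

/-!
# `CoxeterChamberTiling` (stmt-KontsevichZagierPeriods-3818, route SphericalSchlafli) — proof

The item: for honest representations `r = [B⁴ ∩ (W × W), 1]` (`W` the closed wedge of angle `π/9` in a
coordinate plane of `ℝ⁴ = ℝ² × ℝ²`, `B⁴` the closed unit ball) and `b = [B⁴, 1]`,
`324 • [r] − [b] ∈ KZ.relations` — the Coxeter chamber of the `I₂(9) × I₂(9)` tiling is one `324`-th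
of the ball inside the Kontsevich–Zagier rules (rotations are rule-(2) moves, finite domain
additivity). It is verbatim `InverseLandau.tateLifting_coxeterChamberTiling`
(`Theorems/InverseLandauTateLiftingCoxeterChamberTiling.lean`, stub of line `Sketch` of the crux
`TateLifting`, stmt-KontsevichZagierPeriods-9129, lead c10).
-/

namespace Summit.KontsevichZagierPeriods.SphericalSchlafli

/-- **`CoxeterChamberTiling`** (route SphericalSchlafli, stmt-KontsevichZagierPeriods-3818): the
Coxeter chamber `B⁴ ∩ (W × W)` of the four-ball satisfies `324 • [B⁴ ∩ (W × W), 1] − [B⁴, 1] ∈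
KZ.relations`. Proof: `InverseLandau.tateLifting_coxeterChamberTiling`.
[cite: KontsevichZagier2001, §1.2] -/
theorem coxeterChamberTiling_proof :
    Summit.KontsevichZagierPeriods.KontsevichZagierPeriods.Theses.SphericalSchlafli.CoxeterChamberTiling :=
  Summit.KontsevichZagierPeriods.InverseLandau.tateLifting_coxeterChamberTiling

end Summit.KontsevichZagierPeriods.SphericalSchlafli
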